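import Summits.BirchSwinnertonDyer.BirchSwinnertonDyer.Theorems.RamifiedSevenEllipticUnitsRubinFormulaZpBsdp
import Summits.BirchSwinnertonDyer.Rank1Residual.X12.CMTwoTorsion
import Summits.BirchSwinnertonDyer.Rank1Residual.X12.CMTwoTorsionAbsent
import HarnessLib

/-!
# Crux `PrintCFram.BottomClassIndexLawFiveLe` (stmt-BirchSwinnertonDyer-20372), line `relative-anchor-transfer`
# (skeleton `Cruxes/BottomClassIndexLawFiveLe/Lines/relative_anchor_transfer.lean`, sha16 72dde5b866033574):
# the ANCHOR stub `stub_unitAnchor` IS FINITE — seven `(p, j)` classes — and each class anchor is ONE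
# rank-one `BSD(W₀, p)` certificate (cell `bsd-print-cfram`, width seat `bsd-line-cfram-p1-w2`;
# THEOREMS ONLY, `--supports` 20372; nothing asserted, no stub closed, BSD is not proved by any of this)

HONEST FRAMING. The registered stub `stub_unitAnchor` of the line asks, for every globally minimal CM curve
`W/ℚ` of analytic rank one and every prime `p ≥ 5` ramified in the CM field, for an ANCHOR: a globally
minimal CM curve `W₀` with `j(W₀) = j(W)` (same twist class), `CMRamified W₀ p`, `r_an(W₀) = 1`, at which the
analytic ramified Rubin formula `X12.O11.RamifiedCMRubinFormulaAtZp W₀ p` (`S_open` of cell `bsd-cm`) holds.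
This file proves NO anchor. It records, sorry-free, what the stub costs:

* §1 `stub_unitAnchor_of_anchors` — **the stub is FINITE**: by the tree's CM table
  (`hasCM_iff_j_mem_holds`, `X12.eq_of_dvd_cmFieldDiscrOfJ`, `X12.j_eq_of_cmFieldDiscrOfJ_eq_neg_*`) the
  hypotheses `W.HasCM ∧ CMRamified W p ∧ 5 ≤ p` leave exactly SEVEN `(p, j)` classes —
  `(7, −3375)`, `(7, 16581375)`, `(11, −32768)`, `(19, −884736)`, `(43, −884736000)`,
  `(67, −147197952000)`, `(163, −262537412640768000)` — so the `∀∃` stub follows from seven displayed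
  existence statements `∃ W₀, j(W₀) = j₀ ∧ r_an(W₀) = 1 ∧ S_open(W₀, p₀)` (CM and `CMRamified W₀ p₀` are
  automatic from `j₀`). No junk class survives: `HasCM` pins `j` to the thirteen CM values.
* §2 `stub_unitAnchor_of_bsdp_anchors` — **each class anchor is ONE rank-one `BSD(W₀, p)` CERTIFICATE**,
  granted the route's own refereed facts (Cassels' isogeny invariance, entire continuation, GZK — three of
  the four conjuncts of item `PublishedFactsCFram`, stmt-20374): cell `bsd-cm`'s
  `RubinFormulaZpBsdp.ramifiedCMRubinFormulaAtZp_of_bsdp` (`BSD(W₀, p)` at analytic rank `≤ 1` ⟹ `S_open` at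
  `W₀`; no IMC piece, no elliptic-unit input in this direction). With `h₄ : PublishedFactsCFram` (the route
  item S4) the three facts are `h₄.2.2.2`, `h₄.1`, `h₄.2.2.1` (this file imports no route file, by the
  theses-cone rule).
So, CONDITIONAL on S4, `stub_unitAnchor` ⟸ seven rank-one `BSD_p` certificates at CM-RAMIFIED primes:
at `p = 7` cell `bsd-cm`'s Route U books such members (e.g. `49a1^{(−11)}`, `RouteU.bsdp_seven_of_twist_cm7_D11_byClass`,
modulo its displayed binders); at `p ∈ {11, 19, 43, 67, 163}` the natural anchors are Gross's curves `A(p)`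
(`121b1, 361a1, 1849a1, 4489a1, 26569a1`; `r_an = 1` by root number `−1` for `p ≡ 3 (mod 8)` and Miller–Yang 2000),
whose `BSD_p` AT THE RAMIFIED `p` is NOT in print (`E[𝔭]` is a rational line: `ρ̄_{E,p}` reducible, so no
Kolyvagin/Cha index bound at `p`; [BKNO] §1.4 «report elsewhere») — the honest residual of the anchor, one
`p`-isogeny descent + one exact `#Ш_an` `p`-adic unit certificate per class, as Route U did at `7`.
beyond-print theorem: NO.

References: [Miller2011LMS] Def. 1.1 (arXiv:1010.2431 p. 3); [SilvermanATAEC1994] App. A §3 (CM `j`-table);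
[Cassels1965ArithmeticVIII]; [BurungaleKobayashiNakamuraOta2026] arXiv:2608.06879 §1.4 (shape only);
[Gross1980LNM776] (the curves `A(p)`); S. D. Miller, T. Yang, *Non-vanishing of the central derivative of
canonical Hecke L-functions*, Math. Res. Lett. 7 (2000) (context only, not used in the kernel).
-/

noncomputable section

-- summit-side namespace `Summit.BirchSwinnertonDyer.BirchSwinnertonDyer.…` (single-conjunct summit, D-0017 layout)
set_option linter.dupNamespace false

open scoped Classical

open WeierstrassCurve Literature.NumberTheory.EllipticCurves Literature.NumberTheory.EllipticCurves.Rank1Residual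
  Summit.BirchSwinnertonDyer.Rank1Residual
  Summit.BirchSwinnertonDyer.Rank1Residual.X12.O11
  Summit.BirchSwinnertonDyer.BirchSwinnertonDyer.Theorems.RamifiedSevenEllipticUnits

namespace Summit.BirchSwinnertonDyer.BirchSwinnertonDyer.Theorems.PrintCFram.AnchorReduction

/-! ## §0 The seven `(p, j)` classes of the leaf at `p ≥ 5` -/

/-- **The seven classes.** For an elliptic curve `W/ℚ` with (geometric) CM and a prime `p ≥ 5` ramified in
the CM field (`CMRamified W p : p ∣ d_K`), `(p, j(W))` is one of `(7, −3375)`, `(7, 16581375)`,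
`(11, −32768)`, `(19, −884736)`, `(43, −884736000)`, `(67, −147197952000)`, `(163, −262537412640768000)`.
The tree's CM table (`hasCM_iff_j_mem_holds`, `X12.eq_of_dvd_cmFieldDiscrOfJ`) read back to `j`.
[cite: SilvermanATAEC1994, App. A §3 (table of CM j-invariants)] -/
theorem classes_of_cmRamified (W : WeierstrassCurve ℚ) [W.IsElliptic] {p : ℕ} (hp : p.Prime)
    (hCM : W.HasCM) (hram : CMRamified W p) (h5 : 5 ≤ p) :
    (p = 7 ∧ (W.j = -3375 ∨ W.j = 16581375)) ∨ (p = 11 ∧ W.j = -32768) ∨ (p = 19 ∧ W.j = -884736) ∨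
      (p = 43 ∧ W.j = -884736000) ∨ (p = 67 ∧ W.j = -147197952000) ∨
      (p = 163 ∧ W.j = -262537412640768000) := by
  obtain ⟨hp7, hd⟩ := X12.eq_of_dvd_cmFieldDiscrOfJ W hCM hp h5 hram
  rcases hp7 with rfl | rfl | rfl | rfl | rfl | rfl
  · exact Or.inl ⟨rfl, X12.j_eq_of_cmFieldDiscrOfJ_eq_neg_seven (by simpa using hd)⟩
  · exact Or.inr (Or.inl ⟨rfl, X12.j_eq_of_cmFieldDiscrOfJ_eq_neg_eleven (by simpa using hd)⟩)
  · exact Or.inr (Or.inr (Or.inl ⟨rfl, X12.j_eq_of_cmFieldDiscrOfJ_eq_neg_nineteen (by simpa using hd)⟩))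
  · exact Or.inr (Or.inr (Or.inr (Or.inl
      ⟨rfl, X12.j_eq_of_cmFieldDiscrOfJ_eq_neg_fortythree (by simpa using hd)⟩)))
  · exact Or.inr (Or.inr (Or.inr (Or.inr (Or.inl
      ⟨rfl, X12.j_eq_of_cmFieldDiscrOfJ_eq_neg_sixtyseven (by simpa using hd)⟩))))
  · exact Or.inr (Or.inr (Or.inr (Or.inr (Or.inr
      ⟨rfl, X12.j_eq_of_cmFieldDiscrOfJ_eq_neg_onesixtythree (by simpa using hd)⟩))))

/-- CM from the `j`-invariant: each of the seven leaf values is a CM `j`-invariant (`hasCM_iff_j_mem_holds`).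
[cite: SilvermanATAEC1994, App. A §3 (table of CM j-invariants)] -/
theorem hasCM_of_j_eq (W : WeierstrassCurve ℚ) [W.IsElliptic] {j₀ : ℚ}
    (hj₀ : j₀ = -3375 ∨ j₀ = 16581375 ∨ j₀ = -32768 ∨ j₀ = -884736 ∨ j₀ = -884736000 ∨
      j₀ = -147197952000 ∨ j₀ = -262537412640768000) (hj : W.j = j₀) : W.HasCM := by
  refine (hasCM_iff_j_mem_holds W).mpr ?_
  rw [hj]
  simp only [cmJInvariants, Finset.mem_insert, Finset.mem_singleton]
  rcases hj₀ with h | h | h | h | h | h | h <;> subst h <;> norm_num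

/-- `CMRamified W p` from the `j`-invariant: `p ∣ cmFieldDiscrOfJ j₀ = −p` on each of the seven classes.
[cite: SilvermanATAEC1994, App. A §3 (table of CM j-invariants)] -/
theorem cmRamified_of_j_eq (W : WeierstrassCurve ℚ) [W.IsElliptic] {p : ℕ} {j₀ : ℚ}
    (h : (p = 7 ∧ (j₀ = -3375 ∨ j₀ = 16581375)) ∨ (p = 11 ∧ j₀ = -32768) ∨ (p = 19 ∧ j₀ = -884736) ∨
      (p = 43 ∧ j₀ = -884736000) ∨ (p = 67 ∧ j₀ = -147197952000) ∨
      (p = 163 ∧ j₀ = -262537412640768000)) (hj : W.j = j₀) : CMRamified W p := by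
  unfold CMRamified
  rw [hj]
  rcases h with ⟨rfl, hj₀ | hj₀⟩ | ⟨rfl, hj₀⟩ | ⟨rfl, hj₀⟩ | ⟨rfl, hj₀⟩ | ⟨rfl, hj₀⟩ | ⟨rfl, hj₀⟩ <;>
    subst hj₀ <;> norm_num [cmFieldDiscrOfJ]

/-! ## §1 The stub `stub_unitAnchor` from SEVEN displayed anchors (fact-free) -/

/-- **`stub_unitAnchor` IS FINITE: seven anchors give it.** If for each of the seven leaf classes
`(p₀, j₀)` there is a globally minimal elliptic `W₀/ℚ` with `j(W₀) = j₀`, `r_an(W₀) = 1` and the analytic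
ramified Rubin formula `X12.O11.RamifiedCMRubinFormulaAtZp W₀ p₀`, then the registered stub `stub_unitAnchor` of
line `relative-anchor-transfer` holds verbatim (CM and `CMRamified W₀ p` come from `j₀`; `j(W₀) = j(W)` by the
class table). Fact-free; nothing asserted about any anchor. [cite: SilvermanATAEC1994, App. A §3 (table of CM j-invariants)]
[cite: BurungaleKobayashiNakamuraOta2026, §1.4 and Thm. 7.2 (arXiv:2608.06879 pp. 8, 41) (the object `S_open`; claim; preprint; shape only)] -/
theorem stub_unitAnchor_of_anchors
    (h7a : ∀ [Fact (Nat.Prime 7)], ∃ (W₀ : WeierstrassCurve ℚ) (_ : W₀.IsElliptic) (_ : W₀.IsGloballyMinimal),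
      W₀.j = -3375 ∧ W₀.analyticRank = 1 ∧ RamifiedCMRubinFormulaAtZp W₀ 7)
    (h7b : ∀ [Fact (Nat.Prime 7)], ∃ (W₀ : WeierstrassCurve ℚ) (_ : W₀.IsElliptic) (_ : W₀.IsGloballyMinimal),
      W₀.j = 16581375 ∧ W₀.analyticRank = 1 ∧ RamifiedCMRubinFormulaAtZp W₀ 7)
    (h11 : ∀ [Fact (Nat.Prime 11)], ∃ (W₀ : WeierstrassCurve ℚ) (_ : W₀.IsElliptic) (_ : W₀.IsGloballyMinimal),
      W₀.j = -32768 ∧ W₀.analyticRank = 1 ∧ RamifiedCMRubinFormulaAtZp W₀ 11)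
    (h19 : ∀ [Fact (Nat.Prime 19)], ∃ (W₀ : WeierstrassCurve ℚ) (_ : W₀.IsElliptic) (_ : W₀.IsGloballyMinimal),
      W₀.j = -884736 ∧ W₀.analyticRank = 1 ∧ RamifiedCMRubinFormulaAtZp W₀ 19)
    (h43 : ∀ [Fact (Nat.Prime 43)], ∃ (W₀ : WeierstrassCurve ℚ) (_ : W₀.IsElliptic) (_ : W₀.IsGloballyMinimal),
      W₀.j = -884736000 ∧ W₀.analyticRank = 1 ∧ RamifiedCMRubinFormulaAtZp W₀ 43)
    (h67 : ∀ [Fact (Nat.Prime 67)], ∃ (W₀ : WeierstrassCurve ℚ) (_ : W₀.IsElliptic) (_ : W₀.IsGloballyMinimal),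
      W₀.j = -147197952000 ∧ W₀.analyticRank = 1 ∧ RamifiedCMRubinFormulaAtZp W₀ 67)
    (h163 : ∀ [Fact (Nat.Prime 163)], ∃ (W₀ : WeierstrassCurve ℚ) (_ : W₀.IsElliptic)
      (_ : W₀.IsGloballyMinimal),
      W₀.j = -262537412640768000 ∧ W₀.analyticRank = 1 ∧ RamifiedCMRubinFormulaAtZp W₀ 163) :
    ∀ (W : WeierstrassCurve ℚ) [W.IsElliptic] [W.IsGloballyMinimal] (p : ℕ) [Fact p.Prime],
      W.HasCM → CMRamified W p → 5 ≤ p → W.analyticRank = 1 →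
      ∃ (W₀ : WeierstrassCurve ℚ) (_ : W₀.IsElliptic) (_ : W₀.IsGloballyMinimal),
        W₀.HasCM ∧ CMRamified W₀ p ∧ W₀.analyticRank = 1 ∧ W₀.j = W.j ∧ RamifiedCMRubinFormulaAtZp W₀ p := by
  intro W _ _ p hp hCM hram h5 _
  have hcl := classes_of_cmRamified W hp.out hCM hram h5
  -- dispatch on the seven classes; in each, the displayed anchor has the right `j`, CM and `CMRamified`
  rcases hcl with ⟨rfl, hj | hj⟩ | ⟨rfl, hj⟩ | ⟨rfl, hj⟩ | ⟨rfl, hj⟩ | ⟨rfl, hj⟩ | ⟨rfl, hj⟩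
  · obtain ⟨W₀, _, _, hj₀, hr₀, h₀⟩ := h7a
    exact ⟨W₀, ‹_›, ‹_›, hasCM_of_j_eq W₀ (Or.inl rfl) hj₀,
      cmRamified_of_j_eq W₀ (Or.inl ⟨rfl, Or.inl rfl⟩) hj₀, hr₀, hj₀.trans hj.symm, h₀⟩
  · obtain ⟨W₀, _, _, hj₀, hr₀, h₀⟩ := h7b
    exact ⟨W₀, ‹_›, ‹_›, hasCM_of_j_eq W₀ (Or.inr (Or.inl rfl)) hj₀,
      cmRamified_of_j_eq W₀ (Or.inl ⟨rfl, Or.inr rfl⟩) hj₀, hr₀, hj₀.trans hj.symm, h₀⟩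
  · obtain ⟨W₀, _, _, hj₀, hr₀, h₀⟩ := h11
    exact ⟨W₀, ‹_›, ‹_›, hasCM_of_j_eq W₀ (Or.inr (Or.inr (Or.inl rfl))) hj₀,
      cmRamified_of_j_eq W₀ (Or.inr (Or.inl ⟨rfl, rfl⟩)) hj₀, hr₀, hj₀.trans hj.symm, h₀⟩
  · obtain ⟨W₀, _, _, hj₀, hr₀, h₀⟩ := h19
    exact ⟨W₀, ‹_›, ‹_›, hasCM_of_j_eq W₀ (Or.inr (Or.inr (Or.inr (Or.inl rfl)))) hj₀,
      cmRamified_of_j_eq W₀ (Or.inr (Or.inr (Or.inl ⟨rfl, rfl⟩))) hj₀, hr₀, hj₀.trans hj.symm, h₀⟩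
  · obtain ⟨W₀, _, _, hj₀, hr₀, h₀⟩ := h43
    exact ⟨W₀, ‹_›, ‹_›, hasCM_of_j_eq W₀ (Or.inr (Or.inr (Or.inr (Or.inr (Or.inl rfl))))) hj₀,
      cmRamified_of_j_eq W₀ (Or.inr (Or.inr (Or.inr (Or.inl ⟨rfl, rfl⟩)))) hj₀, hr₀, hj₀.trans hj.symm,
      h₀⟩
  · obtain ⟨W₀, _, _, hj₀, hr₀, h₀⟩ := h67
    exact ⟨W₀, ‹_›, ‹_›, hasCM_of_j_eq W₀ (Or.inr (Or.inr (Or.inr (Or.inr (Or.inr (Or.inl rfl)))))) hj₀,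
      cmRamified_of_j_eq W₀ (Or.inr (Or.inr (Or.inr (Or.inr (Or.inl ⟨rfl, rfl⟩))))) hj₀, hr₀,
      hj₀.trans hj.symm, h₀⟩
  · obtain ⟨W₀, _, _, hj₀, hr₀, h₀⟩ := h163
    exact ⟨W₀, ‹_›, ‹_›,
      hasCM_of_j_eq W₀ (Or.inr (Or.inr (Or.inr (Or.inr (Or.inr (Or.inr rfl)))))) hj₀,
      cmRamified_of_j_eq W₀ (Or.inr (Or.inr (Or.inr (Or.inr (Or.inr ⟨rfl, rfl⟩))))) hj₀, hr₀,
      hj₀.trans hj.symm, h₀⟩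

/-! ## §2 Each class anchor is ONE rank-one `BSD(W₀, p)` certificate (modulo the route's refereed facts) -/

/-- **Each anchor is a `BSD(W₀, p₀)` certificate at a rank-one member.** Granted Cassels' isogeny invariance of
the BSD quotient, entire continuation of `L(E/ℚ, s)` and GZK (three conjuncts of the route's item S4
`PublishedFactsCFram`), seven globally minimal elliptic curves `W₀` — one per leaf class `(p₀, j₀)` — with
`r_an(W₀) = 1` and Miller's `BSDp W₀ p₀` give the registered stub `stub_unitAnchor` verbatim: cell `bsd-cm`'s
`RubinFormulaZpBsdp.ramifiedCMRubinFormulaAtZp_of_bsdp` turns each certificate into `S_open` at `W₀` (no IMC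
piece, no elliptic-unit input), and §1 assembles. CONDITIONAL on the three displayed named facts; no
certificate is supplied here (at `p = 7` Route U books them per member modulo its binders; at
`p ∈ {11, 19, 43, 67, 163}` `BSD_p` of a rank-one member at the RAMIFIED `p` is not in print).
[cite: Miller2011LMS, Def. 1.1 (arXiv:1010.2431 p. 3)] [cite: Cassels1965ArithmeticVIII] -/
theorem stub_unitAnchor_of_bsdp_anchors (hCassels : bsdRHS_eq_of_isIsogenous)
    (hmod : hasEntireLFunction_rat) (hGZK : rank_eq_analyticRank_of_analyticRank_le_one)
    (h7a : ∃ (W₀ : WeierstrassCurve ℚ) (_ : W₀.IsElliptic) (_ : W₀.IsGloballyMinimal),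
      W₀.j = -3375 ∧ W₀.analyticRank = 1 ∧ BSDp W₀ 7)
    (h7b : ∃ (W₀ : WeierstrassCurve ℚ) (_ : W₀.IsElliptic) (_ : W₀.IsGloballyMinimal),
      W₀.j = 16581375 ∧ W₀.analyticRank = 1 ∧ BSDp W₀ 7)
    (h11 : ∃ (W₀ : WeierstrassCurve ℚ) (_ : W₀.IsElliptic) (_ : W₀.IsGloballyMinimal),
      W₀.j = -32768 ∧ W₀.analyticRank = 1 ∧ BSDp W₀ 11)
    (h19 : ∃ (W₀ : WeierstrassCurve ℚ) (_ : W₀.IsElliptic) (_ : W₀.IsGloballyMinimal),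
      W₀.j = -884736 ∧ W₀.analyticRank = 1 ∧ BSDp W₀ 19)
    (h43 : ∃ (W₀ : WeierstrassCurve ℚ) (_ : W₀.IsElliptic) (_ : W₀.IsGloballyMinimal),
      W₀.j = -884736000 ∧ W₀.analyticRank = 1 ∧ BSDp W₀ 43)
    (h67 : ∃ (W₀ : WeierstrassCurve ℚ) (_ : W₀.IsElliptic) (_ : W₀.IsGloballyMinimal),
      W₀.j = -147197952000 ∧ W₀.analyticRank = 1 ∧ BSDp W₀ 67)
    (h163 : ∃ (W₀ : WeierstrassCurve ℚ) (_ : W₀.IsElliptic) (_ : W₀.IsGloballyMinimal),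
      W₀.j = -262537412640768000 ∧ W₀.analyticRank = 1 ∧ BSDp W₀ 163) :
    ∀ (W : WeierstrassCurve ℚ) [W.IsElliptic] [W.IsGloballyMinimal] (p : ℕ) [Fact p.Prime],
      W.HasCM → CMRamified W p → 5 ≤ p → W.analyticRank = 1 →
      ∃ (W₀ : WeierstrassCurve ℚ) (_ : W₀.IsElliptic) (_ : W₀.IsGloballyMinimal),
        W₀.HasCM ∧ CMRamified W₀ p ∧ W₀.analyticRank = 1 ∧ W₀.j = W.j ∧ RamifiedCMRubinFormulaAtZp W₀ p := by
  -- each certificate ⟹ `S_open` at the anchor (cell `bsd-cm`, no IMC piece), then §1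
  have lift : ∀ (p₀ : ℕ) [Fact p₀.Prime] (j₀ : ℚ),
      (∃ (W₀ : WeierstrassCurve ℚ) (_ : W₀.IsElliptic) (_ : W₀.IsGloballyMinimal),
        W₀.j = j₀ ∧ W₀.analyticRank = 1 ∧ BSDp W₀ p₀) →
      ∃ (W₀ : WeierstrassCurve ℚ) (_ : W₀.IsElliptic) (_ : W₀.IsGloballyMinimal),
        W₀.j = j₀ ∧ W₀.analyticRank = 1 ∧ RamifiedCMRubinFormulaAtZp W₀ p₀ := by
    intro p₀ _ j₀ ⟨W₀, _, _, hj₀, hr₀, hB⟩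
    exact ⟨W₀, ‹_›, ‹_›, hj₀, hr₀,
      RubinFormulaZpBsdp.ramifiedCMRubinFormulaAtZp_of_bsdp hCassels hmod hGZK hr₀.le hB⟩
  exact stub_unitAnchor_of_anchors (fun {_} => lift 7 _ h7a) (fun {_} => lift 7 _ h7b)
    (fun {_} => lift 11 _ h11) (fun {_} => lift 19 _ h19) (fun {_} => lift 43 _ h43)
    (fun {_} => lift 67 _ h67) (fun {_} => lift 163 _ h163)

end Summit.BirchSwinnertonDyer.BirchSwinnertonDyer.Theorems.PrintCFram.AnchorReduction

end
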